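import Literature.MathematicalPhysics.KineticTheory.HardSphereEuler
import HarnessLib

/-!
# Pair kinematics and the backward perpetuity of the line `pedigree-perpetuity`
# (crux `EnergyCurrentTails`, stmt-AtomisticToContinuum-9235)

Support file (`--supports stmt-AtomisticToContinuum-9235`) of the line lead (seat c3,
`prover-line-stmt-AtomisticToContinuum-9235-c3-0`): the PROVED elementary half of the line, copied
verbatim from §0–§1 of the skeleton `Cruxes/EnergyCurrentTails/Lines/pedigree_perpetuity.lean`
(planner `planner-cruxplan-stmt-AtomisticToContinuum-9235-pedigree-perpetuity-0`).

* §0 exact pair energy exchange under the elastic law `reflectVel ω` for a unit impact vector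
  (`norm_sq_reflectVel_fst/snd/add`) and the PACKET STEP for the followed branch: the projectile keeps
  at most its share `1 − cos²` of its energy plus the partner's (`packet_step_fst`), the target receives
  at most the share `cos²` plus its own (`packet_step_snd`);
* §1 the real analysis of the line: the BACKWARD PERPETUITY `E 0 ≤ Σ_{n<K} q n Π_{j<n} s j + E K Π_{j<K} s j`
  from `E n ≤ s n * E (n+1) + q n` (`backward_perpetuity`, the registered helper of this file), the
  discount weights `Π_{j<n} s j ≤ (1−δ)^{#good j<n}` (`prod_le_pow_card_good`), and the regrouping of
  discounted counts by blocks with allowances (`sum_pow_eq_sum_fiber`, `sum_fiber_le_of_allowance`).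

These are the tools of the registered stubs `stub_lineageLedgerSure` (packet step) and
`stub_levelInclusion` (perpetuity, weights, block sums) over the vocabulary file
`…Theorems.OneFlightGossipEngineEnergyCurrentTailsPedigreeObjects`.
-/

noncomputable section

open Set
open scoped InnerProductSpace BigOperators

namespace Summit.AtomisticToContinuum.HydrodynamicLimit.Theorems.EnergyCurrentTailsPedigree

open Literature.MathematicalPhysics.KineticTheory Literature.Analysis.FluidPDE

/-! ## §0 Pair kinematics (proved): the packet step for the followed branch -/

/-- Energy exchange (exact): `‖v'‖² = ‖v‖² − ⟪v,ω⟫² + ⟪w,ω⟫²` for a unit impact vector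
(as in `Cruxes/EnergyCurrentTails/IdeatorOneSketch.lean`). -/
theorem norm_sq_reflectVel_fst (v w ω : V3) (hω : ‖ω‖ = 1) :
    ‖(reflectVel ω (v, w)).1‖ ^ 2 = ‖v‖ ^ 2 - ⟪v, ω⟫_ℝ ^ 2 + ⟪w, ω⟫_ℝ ^ 2 := by
  have h1 : ‖ω‖ ^ 2 = 1 := by rw [hω]; norm_num
  have hc : ⟪v - w, ω⟫_ℝ = ⟪v, ω⟫_ℝ - ⟪w, ω⟫_ℝ := inner_sub_left _ _ _
  simp only [reflectVel, h1, div_one]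
  rw [norm_sub_sq_real, norm_smul, mul_pow, Real.norm_eq_abs, sq_abs, h1, inner_smul_right, hc]
  ring

/-- Energy exchange (exact): `‖w'‖² = ‖w‖² + ⟪v,ω⟫² − ⟪w,ω⟫²`. -/
theorem norm_sq_reflectVel_snd (v w ω : V3) (hω : ‖ω‖ = 1) :
    ‖(reflectVel ω (v, w)).2‖ ^ 2 = ‖w‖ ^ 2 + ⟪v, ω⟫_ℝ ^ 2 - ⟪w, ω⟫_ℝ ^ 2 := by
  have h1 : ‖ω‖ ^ 2 = 1 := by rw [hω]; norm_num
  have hc : ⟪v - w, ω⟫_ℝ = ⟪v, ω⟫_ℝ - ⟪w, ω⟫_ℝ := inner_sub_left _ _ _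
  simp only [reflectVel, h1, div_one]
  rw [norm_add_sq_real, norm_smul, mul_pow, Real.norm_eq_abs, sq_abs, h1, inner_smul_right, hc]
  ring

/-- Pair energy conservation. -/
theorem norm_sq_reflectVel_add (v w ω : V3) (hω : ‖ω‖ = 1) :
    ‖(reflectVel ω (v, w)).1‖ ^ 2 + ‖(reflectVel ω (v, w)).2‖ ^ 2 = ‖v‖ ^ 2 + ‖w‖ ^ 2 := by
  rw [norm_sq_reflectVel_fst v w ω hω, norm_sq_reflectVel_snd v w ω hω]; ring

/-- `⟪w, ω⟫² ≤ ‖w‖²` for a unit vector `ω` (Cauchy–Schwarz). -/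
theorem inner_sq_le_norm_sq (w ω : V3) (hω : ‖ω‖ = 1) : ⟪w, ω⟫_ℝ ^ 2 ≤ ‖w‖ ^ 2 := by
  have h := abs_real_inner_le_norm w ω
  rw [hω, mul_one] at h
  nlinarith [abs_nonneg ⟪w, ω⟫_ℝ, sq_abs ⟪w, ω⟫_ℝ]

/-- **Packet step, projectile branch**: the projectile keeps at most its share `1 − cos²` of its own
energy plus the partner's energy: `‖v'‖² ≤ (‖v‖² − ⟪v,ω⟫²) + ‖w‖²`. -/
theorem packet_step_fst (v w ω : V3) (hω : ‖ω‖ = 1) :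
    ‖(reflectVel ω (v, w)).1‖ ^ 2 ≤ (‖v‖ ^ 2 - ⟪v, ω⟫_ℝ ^ 2) + ‖w‖ ^ 2 := by
  rw [norm_sq_reflectVel_fst v w ω hω]
  linarith [inner_sq_le_norm_sq w ω hω]

/-- **Packet step, target branch**: the target receives at most the share `cos²` of the projectile's
energy plus its own: `‖w'‖² ≤ ⟪v,ω⟫² + ‖w‖²`. -/
theorem packet_step_snd (v w ω : V3) (hω : ‖ω‖ = 1) :
    ‖(reflectVel ω (v, w)).2‖ ^ 2 ≤ ⟪v, ω⟫_ℝ ^ 2 + ‖w‖ ^ 2 := by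
  rw [norm_sq_reflectVel_snd v w ω hω]
  linarith [sq_nonneg ⟪w, ω⟫_ℝ]

/-- The two branch shares are complementary fractions of the projectile energy. -/
theorem shares_sum (v ω : V3) :
    (‖v‖ ^ 2 - ⟪v, ω⟫_ℝ ^ 2) + ⟪v, ω⟫_ℝ ^ 2 = ‖v‖ ^ 2 := by ring

/-! ## §1 Real analysis of the line (proved): backward perpetuity, discount weights, block sums -/

/-- **Backward perpetuity.**  If `E n ≤ s n * E (n+1) + q n` for `n < K` with `s n ≥ 0`, then
`E 0 ≤ Σ_{n<K} q n * (Π_{j<n} s j) + E K * Π_{j<K} s j`. -/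
theorem backward_perpetuity : ∀ (E s q : ℕ → ℝ), (∀ n, 0 ≤ s n) →
    ∀ K : ℕ, (∀ n, n < K → E n ≤ s n * E (n + 1) + q n) →
      E 0 ≤ (∑ n ∈ Finset.range K, q n * ∏ j ∈ Finset.range n, s j)
        + E K * ∏ j ∈ Finset.range K, s j := by
  intro E s q hs K
  induction K with
  | zero => intro _; simp
  | succ K ih =>
    intro hstep
    have hK := ih (fun n hn => hstep n (Nat.lt_succ_of_lt hn))
    have hw : 0 ≤ ∏ j ∈ Finset.range K, s j := Finset.prod_nonneg fun j _ => hs j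
    have hlast := hstep K (Nat.lt_succ_self K)
    have hmul : E K * ∏ j ∈ Finset.range K, s j
        ≤ (s K * E (K + 1) + q K) * ∏ j ∈ Finset.range K, s j :=
      mul_le_mul_of_nonneg_right hlast hw
    rw [Finset.sum_range_succ, Finset.prod_range_succ]
    nlinarith [hmul]

/-- **Discount weights**: if all `s j ∈ [0,1]` and `s j ≤ 1 − δ` on good steps, then
`Π_{j<n} s j ≤ (1−δ)^{#good j < n}`. -/
theorem prod_le_pow_card_good (s : ℕ → ℝ) (δ : ℝ) (good : ℕ → Prop) [DecidablePred good]
    (hδ : δ ≤ 1) (hs0 : ∀ j, 0 ≤ s j) (hs1 : ∀ j, s j ≤ 1) (hgood : ∀ j, good j → s j ≤ 1 - δ)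
    (n : ℕ) :
    ∏ j ∈ Finset.range n, s j ≤ (1 - δ) ^ ((Finset.range n).filter good).card := by
  induction n with
  | zero => simp
  | succ n ih =>
    have hw : 0 ≤ ∏ j ∈ Finset.range n, s j := Finset.prod_nonneg fun j _ => hs0 j
    have hp : 0 ≤ (1 - δ) ^ ((Finset.range n).filter good).card := pow_nonneg (by linarith) _
    rw [Finset.prod_range_succ, Finset.range_add_one, Finset.filter_insert]
    by_cases hg : good n
    · rw [if_pos hg, Finset.card_insert_of_notMem (by simp), pow_succ]
      exact mul_le_mul ih (hgood n hg) (hs0 n) hp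
    · rw [if_neg hg]
      calc (∏ j ∈ Finset.range n, s j) * s n ≤ (1 - δ) ^ ((Finset.range n).filter good).card * 1 :=
            mul_le_mul ih (hs1 n) (hs0 n) hp
        _ = _ := mul_one _

/-- **Block sums**: regrouping the discounted count by the number `G n` of good steps before `n`,
`Σ_{n<K} (1−δ)^{G n} = Σ_g (1−δ)^g · #{n < K : G n = g}`. -/
theorem sum_pow_eq_sum_fiber (δ : ℝ) (G : ℕ → ℕ) (K gmax : ℕ) (hG : ∀ n, n < K → G n < gmax) :
    ∑ n ∈ Finset.range K, (1 - δ) ^ G n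
      = ∑ g ∈ Finset.range gmax, (1 - δ) ^ g * (((Finset.range K).filter fun n => G n = g).card : ℝ) := by
  rw [← Finset.sum_fiberwise_of_maps_to (g := G) (t := Finset.range gmax)
    (fun n hn => Finset.mem_range.2 (hG n (Finset.mem_range.1 hn)))]
  refine Finset.sum_congr rfl fun g _ => ?_
  rw [Finset.sum_congr rfl fun n hn => by rw [(Finset.mem_filter.1 hn).2], Finset.sum_const,
    nsmul_eq_mul, mul_comm]

/-- **Allowances**: if block `g` has at most `m + g + 1` members then the discounted count is at most
`Σ_g (1−δ)^g (m+g+1)` (finite horizon; the infinite series is `(m+1)/δ + (1−δ)/δ²`). -/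
theorem sum_fiber_le_of_allowance (δ : ℝ) (hδ1 : δ ≤ 1) (G : ℕ → ℕ) (K gmax m : ℕ)
    (hG : ∀ n, n < K → G n < gmax)
    (hall : ∀ g, ((Finset.range K).filter fun n => G n = g).card ≤ m + g + 1) :
    ∑ n ∈ Finset.range K, (1 - δ) ^ G n
      ≤ ∑ g ∈ Finset.range gmax, (1 - δ) ^ g * ((m + g + 1 : ℕ) : ℝ) := by
  rw [sum_pow_eq_sum_fiber δ G K gmax hG]
  refine Finset.sum_le_sum fun g _ => ?_
  have hp : 0 ≤ (1 - δ) ^ g := pow_nonneg (by linarith) _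
  exact mul_le_mul_of_nonneg_left (by exact_mod_cast hall g) hp

end Summit.AtomisticToContinuum.HydrodynamicLimit.Theorems.EnergyCurrentTailsPedigree

end
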